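import Literature.MathematicalPhysics.QuantumLattice.InfVolFermionStateParticleHoleHubbardEnergy
import Literature.MathematicalPhysics.QuantumLattice.InfVolFermionStateParticleHolePairAmplitude
import Literature.MathematicalPhysics.QuantumLattice.InfVolFermionStateTTPrimeMeanEnergyBox
import HarnessLib

/-!
# The particle–hole transform of the `t–t'` and of the `d`-wave–SOURCED mean energy at `t' ≠ 0`:
# `e^{t,t',U}(ω ∘ α) = e^{t,−t',U}(ω) + U(1 − ρ(ω))`, and the canonical sourced minimisers at `(t', n)` are
# the images of those at `(−t', 2 − n)` with the SAME `Re ω(P₀^d)` — electron-doped response words from hole-doped ones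

Topic `MathematicalPhysics/QuantumLattice` (namespace = path; family `hubbard`). Sequel of
`InfVolFermionStateParticleHoleHubbardEnergy` (the state-level particle–hole dictionary of the NEAREST-NEIGHBOUR Hubbard
mean energy, `e^{t,U}(ω ∘ α) = e^{t,U}(ω) + U(1 − ρ(ω))`, and its `t' = 0` pencil) and of
`InfVolFermionStateParticleHolePairAmplitude` (`Re (ω ∘ α)(P_x^d) = Re ω(P_x^d)`). Here the DIAGONAL hopping is added: the two
ends of a next-nearest-neighbour bond `{x, x + j_s}` (`j_s = e₁ ± e₂`) lie on the SAME sublattice (`ε_{x+j_s} = ε_x`,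
`siteStagger_add_diagVec`), so the staggered particle–hole automorphism `α` (`c_{xσ} ↦ ε_x c†_{xσ}`) REVERSES the sign of
the diagonal bond term (`phAut_diagHoppingΦ_pair`: `α(Φ^{t'}{x, x+j_s}) = Φ^{−t'}{x, x+j_s}`) while it fixes the
nearest-neighbour one — the state-level form of the Lieb–Wu / Essler dictionary `e(t, t', U, 2 − n) = e(t, −t', U, n) + U(1 − n)`
(energy-density FUNCTION form: `HubbardNNNHoppingEnergyDensityParticleHole`, cell words: `HubbardTTPrimeParticleHoleImageWords`).

* §1 `siteStagger_diagVec`, `siteStagger_add_diagVec`, `phAut_diagHoppingΦ_pair`.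
* §2 `InfVolFermionState.particleHole_expect_diagHoppingΦ_pair`;
  **`IsTranslationInvariant.meanEnergy_hubbardTTPrime_particleHole`**: for every translation-invariant `ω` on `ℤ²`,
  `e^{t,t',U}(ω ∘ α) = e^{t,−t',U}(ω) + U(1 − ρ(ω))`.
* §3 **`IsTranslationInvariant.meanEnergy_hubbardTTPrimeSourced_dWave_particleHole`**: for the `d`-wave–sourced pencil
  `E^{src} = H^{t,t',U} − μN − h(Δ_d + Δ_d†)` (Koma–Tasaki 1994 §1 source, `hubbardTTPrimeSourcedInteraction t t' U μ d h`),
  `e^{src}_{t',μ,h}(ω ∘ α) = e^{src}_{−t',μ,h}(ω) + (U − 2μ)(1 − ρ(ω))` (the pair-source energy `2h·Re ω(P₀^d)` is invariant).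
* §4 THE CANONICAL CLASS: `IsTranslationInvariant.forall_meanEnergy_sourced_particleHole_le` — a translation-invariant state of
  density `n` minimising `e^{src}_{t'}` among translation-invariant states of density `n` is carried by `α` to a minimiser of
  `e^{src}_{−t'}` among those of density `2 − n` (the shift `(U − 2μ)(1 − ρ)` is constant on a density class);
  **`sourcedMinimisers_responseFloor_of_particleHole`** — the response-word TRANSFER: «density-`(2 − n)` minimisers of
  `e^{src}_{−t'}` exist and every one has `b ≤ Re ω(P₀^d)`» ⇒ «density-`n` minimisers of `e^{src}_{t'}` exist and every one has
  `b ≤ Re ω(P₀^d)`». This is the device by which a pairing-RESPONSE floor word certified on a HOLE-doped box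
  `(−t', U, 2 − n)` is read on the ELECTRON-doped box `(t', U, n)` (e.g. the `t' > 0`, `n > 1` router boxes of Sr₂IrO₄ /
  electron-doped cuprates), with no loss.

Everything is PROVED; no definition, no named fact, zero compute. HONEST SCOPE: an exact symmetry of the one-band `t–t'–U`
model on the square lattice (bipartite nearest-neighbour graph); it says nothing about three-band / material asymmetries between
hole and electron doping, and the words it transports stay what they were (large-field finite-`h` responses, not order parameters).

References: E. H. Lieb, PRL 62 (1989) 1201, proof of Thm 2 [LiebPRL1989]; E. H. Lieb, F. Y. Wu, Physica A 321 (2003) 1, §1 eq. (3)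
[LiebWuPhysicaA2003]; F. H. L. Essler et al., *The One-Dimensional Hubbard Model* (2005) §2.2.4 [EsslerEtAl2005]; H. Tasaki,
*Physics and Mathematics of Quantum Many-Body Systems* (2020) §9.3.3 [Tasaki2020]; T. Koma, H. Tasaki, J. Stat. Phys. 76 (1994)
745, §1 [KomaTasaki1994]; O. Bratteli, A. Kishimoto, D. W. Robinson, CMP 64 (1978) 41, §3 [BratteliKishimotoRobinson1978].

## Mathlib / tree search
REUSED: `phAut_cAt`, `phAut_cAt_conjTranspose`, `siteStagger_add`, `InfVolFermionState.particleHole_expect`,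
`IsTranslationInvariant.particleHole`, `IsTranslationInvariant.isEven`, `density_particleHole`,
`IsTranslationInvariant.hubbardEnergyDensity_particleHole`, `IsTranslationInvariant.meanEnergy_hubbardTTPrime_eq`,
`meanEnergy_hubbardTTPrimeSourced`, `meanEnergy_pairSourceInteraction_dWave_eq`, `re_particleHole_expect_localPairAt_dWave`,
`diagHoppingFermionInteraction_apply_pair`, `creation_mul_annihilation_eq_neg_of_ne`, `Int.negOnePow_add`.
`lean search 'particleHole.*TTPrime|TTPrime.*particleHole|phAut.*diag'`: only the `t' = 0` pencil
(`meanEnergy_hubbardTTPrime_zero_particleHole`, `DWaveOrderParameterParticleHole`) — the `t' ≠ 0` state-level form is new here.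
-/

noncomputable section

namespace Literature.MathematicalPhysics.QuantumLattice

open Matrix Finset HubbardWave0 Literature.Probability.LatticeModels ThermodynamicLimit
open scoped ComplexOrder BigOperators

/-! ### §1 The diagonal bond under the staggered particle–hole automorphism -/

section Terms

/-- A diagonal step `j_s = e₁ ± e₂` has stagger `+1` (it joins sites of the same sublattice). [cite: LiebPRL1989, proof of Theorem 2] -/
theorem siteStagger_diagVec (s : Fin 2) : siteStagger (diagVec s) = 1 := by
  unfold siteStagger
  rw [Fin.sum_univ_two, diagVec_apply_zero, diagVec_apply_one]
  split_ifs
  · rw [Int.negOnePow_add, Int.negOnePow_one, neg_mul_neg, one_mul]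
  · rw [add_neg_cancel, Int.negOnePow_zero]

/-- `ε_{x + j_s} = ε_x`. [cite: LiebPRL1989, proof of Theorem 2] -/
theorem siteStagger_add_diagVec (x : Site 2) (s : Fin 2) : siteStagger (x + diagVec s) = siteStagger x := by
  rw [siteStagger_add, siteStagger_diagVec, mul_one]

/-- **`α(Φ^{t'}{x, x + j_s}) = Φ^{−t'}{x, x + j_s}`**: the diagonal bond term CHANGES SIGN under the staggered particle–hole
automorphism (both ends carry the same stagger, and `c_{xσ} c†_{yσ} = −c†_{yσ} c_{xσ}` for `x ≠ y`, so
`α(c†_x c_y + c†_y c_x) = −(c†_y c_x + c†_x c_y)`). [cite: LiebPRL1989, proof of Theorem 2] [cite: EsslerEtAl2005, §2.2.4] -/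
theorem phAut_diagHoppingΦ_pair (t' : ℝ) (x : Site 2) (s : Fin 2) :
    phAut {x, x + diagVec s} ((diagHoppingFermionInteraction t').Φ {x, x + diagVec s}) =
      (diagHoppingFermionInteraction (-t')).Φ {x, x + diagVec s} := by
  have hxy : x ≠ x + diagVec s := self_ne_add_diagVec x s
  have hx : x ∈ ({x, x + diagVec s} : Finset (Site 2)) := mem_insert_self _ _
  have hy : x + diagVec s ∈ ({x, x + diagVec s} : Finset (Site 2)) := mem_insert_of_mem (mem_singleton_self _)
  have hε : ((((siteStagger x : ℤˣ) : ℤ) : ℂ)) * (((siteStagger (x + diagVec s) : ℤˣ) : ℤ) : ℂ) = 1 := by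
    rw [siteStagger_add_diagVec, ← Int.cast_mul, ← Units.val_mul, Int.units_mul_self, Units.val_one, Int.cast_one]
  have hε' : ((((siteStagger (x + diagVec s) : ℤˣ) : ℤ) : ℂ)) * (((siteStagger x : ℤˣ) : ℤ) : ℂ) = 1 := by
    rw [mul_comm, hε]
  have hne : ∀ σ : Fin 2, orb (PolySite.pt x hx) σ ≠ orb (PolySite.pt (x + diagVec s) hy) σ := by
    intro σ h
    have h1 := (orb_eq_orb_iff.1 h).1
    exact hxy (toLex.injective (congrArg Subtype.val h1))
  have hswap : ∀ σ : Fin 2,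
      cAt x hx σ * (cAt (x + diagVec s) hy σ)ᴴ = -((cAt (x + diagVec s) hy σ)ᴴ * cAt x hx σ) := fun σ => by
    rw [cAt, cAt, annihilation_conjTranspose, creation_mul_annihilation_eq_neg_of_ne (hne σ).symm, neg_neg]
  have hswap' : ∀ σ : Fin 2,
      cAt (x + diagVec s) hy σ * (cAt x hx σ)ᴴ = -((cAt x hx σ)ᴴ * cAt (x + diagVec s) hy σ) := fun σ => by
    rw [cAt, cAt, annihilation_conjTranspose, creation_mul_annihilation_eq_neg_of_ne (hne σ), neg_neg]
  have hterm : ∀ σ : Fin 2,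
      phAut {x, x + diagVec s} ((cAt x hx σ)ᴴ * cAt (x + diagVec s) hy σ + (cAt (x + diagVec s) hy σ)ᴴ * cAt x hx σ) =
        -((cAt x hx σ)ᴴ * cAt (x + diagVec s) hy σ + (cAt (x + diagVec s) hy σ)ᴴ * cAt x hx σ) := by
    intro σ
    rw [map_add, map_mul, map_mul, phAut_cAt_conjTranspose, phAut_cAt, phAut_cAt_conjTranspose, phAut_cAt,
      smul_mul_smul, smul_mul_smul, hε, hε', hswap, hswap', one_smul, one_smul, neg_add]
    exact add_comm _ _
  rw [diagHoppingFermionInteraction_apply_pair, diagHoppingFermionInteraction_apply_pair, map_smul, map_sum]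
  simp_rw [hterm]
  simp only [Finset.sum_neg_distrib, smul_neg, neg_smul, neg_neg, Complex.ofReal_neg]

end Terms

/-! ### §2 The `t–t'` mean energy of the particle–hole transform (`t' ↦ −t'`) -/

namespace InfVolFermionState

variable {ω : InfVolFermionState 2}

/-- The diagonal bond term of the transform: `(ω ∘ α)(Φ^{t'}{x, x + j_s}) = ω(Φ^{−t'}{x, x + j_s})` (every state).
[cite: LiebPRL1989, proof of Theorem 2] -/
theorem particleHole_expect_diagHoppingΦ_pair (t' : ℝ) (x : Site 2) (s : Fin 2) :
    ω.particleHole.expect {x, x + diagVec s} ((diagHoppingFermionInteraction t').Φ {x, x + diagVec s}) =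
      ω.expect {x, x + diagVec s} ((diagHoppingFermionInteraction (-t')).Φ {x, x + diagVec s}) := by
  rw [particleHole_expect, phAut_diagHoppingΦ_pair]

/-- **THE PARTICLE–HOLE TRANSFORM OF THE `t–t'` MEAN ENERGY**: for every translation-invariant state `ω` on `ℤ²`,
`e^{t,t',U}(ω ∘ α) = e^{t,−t',U}(ω) + U(1 − ρ(ω))` — nearest-neighbour bonds are invariant, diagonal bonds flip (`t' ↦ −t'`),
the on-site term gives `U(1 − ρ)`. State-level form of `P H(t,t',U) P† = H(t,−t',U) − UN + U|Λ|`.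
[cite: LiebPRL1989, proof of Theorem 2] [cite: LiebWuPhysicaA2003, §1 eq. (3)] [cite: BratteliKishimotoRobinson1978, §3 (mean energy functional)] -/
theorem IsTranslationInvariant.meanEnergy_hubbardTTPrime_particleHole (hω : ω.IsTranslationInvariant) (t t' U : ℝ) :
    ω.particleHole.meanEnergy (hubbardTTPrimeFermionInteraction t t' U) 1 =
      ω.meanEnergy (hubbardTTPrimeFermionInteraction t (-t') U) 1 + U * (1 - ω.density) := by
  have hω' : ω.particleHole.IsTranslationInvariant := hω.particleHole (hω.isEven two_pos)
  rw [hω'.meanEnergy_hubbardTTPrime_eq t' t U, hω.meanEnergy_hubbardTTPrime_eq (-t') t U,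
    hω.hubbardEnergyDensity_particleHole t U two_pos]
  simp_rw [particleHole_expect_diagHoppingΦ_pair]
  ring

/-! ### §3 The `d`-wave–sourced pencil -/

/-- **THE PARTICLE–HOLE TRANSFORM OF THE SOURCED MEAN ENERGY**: for every translation-invariant `ω`,
`e^{src}_{t,t',U,μ,h}(ω ∘ α) = e^{src}_{t,−t',U,μ,h}(ω) + (U − 2μ)(1 − ρ(ω))` (`e^{src} = e^{tt'} − μρ − 2h·Re ω(P₀^d)`;
the `d`-wave pair amplitude's real part is particle–hole invariant). [cite: KomaTasaki1994, §1] [cite: LiebPRL1989, proof of Theorem 2] -/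
theorem IsTranslationInvariant.meanEnergy_hubbardTTPrimeSourced_dWave_particleHole (hω : ω.IsTranslationInvariant)
    (t t' U μ h : ℝ) :
    ω.particleHole.meanEnergy (hubbardTTPrimeSourcedInteraction t t' U μ dWaveFormFactor h) 1 =
      ω.meanEnergy (hubbardTTPrimeSourcedInteraction t (-t') U μ dWaveFormFactor h) 1 + (U - 2 * μ) * (1 - ω.density) := by
  rw [meanEnergy_hubbardTTPrimeSourced, meanEnergy_hubbardTTPrimeSourced, hω.meanEnergy_hubbardTTPrime_particleHole,
    meanEnergy_pairSourceInteraction_dWave_eq, meanEnergy_pairSourceInteraction_dWave_eq,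
    re_particleHole_expect_localPairAt_dWave, density_particleHole]
  ring

/-! ### §4 The canonical (fixed-density) class of sourced minimisers and the response-word transfer -/

/-- **Canonical sourced minimisers at `(t', n)` ↦ at `(−t', 2 − n)`**: if the translation-invariant `ω` of density `n`
minimises `e^{src}_{t'}` over the translation-invariant states of density `n`, then `ω ∘ α` (density `2 − n`) minimises
`e^{src}_{−t'}` over those of density `2 − n` (the shift `(U − 2μ)(1 − ρ)` is constant on a density class, `α` is an involution
of the translation-invariant states). [cite: LiebPRL1989, proof of Theorem 2] [cite: BratteliKishimotoRobinson1978, Thm. 2 (condition 2)] -/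
theorem IsTranslationInvariant.forall_meanEnergy_sourced_particleHole_le (hω : ω.IsTranslationInvariant) {n : ℝ}
    (hρ : ω.density = n) (t t' U μ h : ℝ)
    (hmin : ∀ ω' : InfVolFermionState 2, ω'.IsTranslationInvariant → ω'.density = n →
      ω.meanEnergy (hubbardTTPrimeSourcedInteraction t t' U μ dWaveFormFactor h) 1 ≤
        ω'.meanEnergy (hubbardTTPrimeSourcedInteraction t t' U μ dWaveFormFactor h) 1) :
    ∀ ω' : InfVolFermionState 2, ω'.IsTranslationInvariant → ω'.density = 2 - n →
      ω.particleHole.meanEnergy (hubbardTTPrimeSourcedInteraction t (-t') U μ dWaveFormFactor h) 1 ≤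
        ω'.meanEnergy (hubbardTTPrimeSourcedInteraction t (-t') U μ dWaveFormFactor h) 1 := by
  intro ω' hω' hρ'
  have h1 := hmin ω'.particleHole (hω'.particleHole (hω'.isEven two_pos)) (by rw [density_particleHole, hρ']; ring)
  have h2 := hω'.meanEnergy_hubbardTTPrimeSourced_dWave_particleHole t t' U μ h
  have h3 := hω.meanEnergy_hubbardTTPrimeSourced_dWave_particleHole t (-t') U μ h
  rw [neg_neg, hρ] at h3
  rw [h2, hρ'] at h1
  rw [h3]
  linarith

/-- **RESPONSE-WORD TRANSFER (hole-doped ⇒ electron-doped and back)**: if translation-invariant density-`(2 − n)` minimisers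
of `e^{src}_{t,−t',U,μ,h}` EXIST and EVERY one has `b ≤ Re ω(P₀^d)`, then translation-invariant density-`n` minimisers of
`e^{src}_{t,t',U,μ,h}` exist and every one has `b ≤ Re ω(P₀^d)` — the image of a minimiser is a minimiser of the mirrored class
and `Re (ω ∘ α)(P₀^d) = Re ω(P₀^d)`. Exact: a certified finite-`h` pairing-response floor word on the box `(−t', U, 2 − n)` IS the
same word on `(t', U, n)`. [cite: LiebPRL1989, proof of Theorem 2] [cite: KomaTasaki1994, §1] [cite: EsslerEtAl2005, §2.2.4] -/
theorem sourcedMinimisers_responseFloor_of_particleHole {t t' U μ h n b : ℝ}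
    (H : (∃ ω : InfVolFermionState 2, ω.IsTranslationInvariant ∧ ω.density = 2 - n ∧
        ∀ ω' : InfVolFermionState 2, ω'.IsTranslationInvariant → ω'.density = 2 - n →
          ω.meanEnergy (hubbardTTPrimeSourcedInteraction t (-t') U μ dWaveFormFactor h) 1 ≤
            ω'.meanEnergy (hubbardTTPrimeSourcedInteraction t (-t') U μ dWaveFormFactor h) 1) ∧
      ∀ ω : InfVolFermionState 2, ω.IsTranslationInvariant → ω.density = 2 - n →
        (∀ ω' : InfVolFermionState 2, ω'.IsTranslationInvariant → ω'.density = 2 - n →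
          ω.meanEnergy (hubbardTTPrimeSourcedInteraction t (-t') U μ dWaveFormFactor h) 1 ≤
            ω'.meanEnergy (hubbardTTPrimeSourcedInteraction t (-t') U μ dWaveFormFactor h) 1) →
        b ≤ (ω.expect (pairRegion (insert 0 unitSteps) 0) (localPairAt (insert 0 unitSteps) dWaveFormFactor 0)).re) :
    (∃ ω : InfVolFermionState 2, ω.IsTranslationInvariant ∧ ω.density = n ∧
        ∀ ω' : InfVolFermionState 2, ω'.IsTranslationInvariant → ω'.density = n →
          ω.meanEnergy (hubbardTTPrimeSourcedInteraction t t' U μ dWaveFormFactor h) 1 ≤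
            ω'.meanEnergy (hubbardTTPrimeSourcedInteraction t t' U μ dWaveFormFactor h) 1) ∧
      ∀ ω : InfVolFermionState 2, ω.IsTranslationInvariant → ω.density = n →
        (∀ ω' : InfVolFermionState 2, ω'.IsTranslationInvariant → ω'.density = n →
          ω.meanEnergy (hubbardTTPrimeSourcedInteraction t t' U μ dWaveFormFactor h) 1 ≤
            ω'.meanEnergy (hubbardTTPrimeSourcedInteraction t t' U μ dWaveFormFactor h) 1) →
        b ≤ (ω.expect (pairRegion (insert 0 unitSteps) 0) (localPairAt (insert 0 unitSteps) dWaveFormFactor 0)).re := by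
  obtain ⟨⟨ω₀, hω₀, hρ₀, hmin₀⟩, hall⟩ := H
  refine ⟨⟨ω₀.particleHole, hω₀.particleHole (hω₀.isEven two_pos), by rw [density_particleHole, hρ₀]; ring, ?_⟩,
    fun ω hω hρ hmin => ?_⟩
  · have h := hω₀.forall_meanEnergy_sourced_particleHole_le hρ₀ t (-t') U μ h hmin₀
    simpa only [neg_neg, sub_sub_cancel] using h
  · have h := hall ω.particleHole (hω.particleHole (hω.isEven two_pos)) (by rw [density_particleHole, hρ])
      (hω.forall_meanEnergy_sourced_particleHole_le hρ t t' U μ h hmin)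
    rwa [re_particleHole_expect_localPairAt_dWave] at h

end InfVolFermionState

end Literature.MathematicalPhysics.QuantumLattice

end
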